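import Summits.ResolutionOfSingularities.ResolutionOfSingularities.Theorems.PurelyInseparableDim4ResConeFrameConjugation
import Summits.ResolutionOfSingularities.ResolutionOfSingularities.Theorems.PurelyInseparableDim4ResConeLossyPairLedger
import Literature.Barriers.ResolutionOfSingularities.KangarooShadeIncrease
import HarnessLib
import HarnessLib.Audit.Tags

/-!
# Purely inseparable four-folds — STRAIGHTENING A TILTED BINARY CONE: in the linear frame of its polar kernel the
# residual cone is INERT, and the quadratic contact jet does not touch the initial form
# (K2(p) lane, SLICE C, brick (ii) «tilted reduction», FILE 3b: pure algebra; file-holder res-dim4-p-5 g4)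

[OURS · counted 0 · cell `res-dim4-pi` · K2(p) lane, slice C (desk WORD #155) · seat p-5 g4.]
Nothing here proves K2(p)/K2(5), `NoIsolatedTrap p p` or resolution of singularities in dimension ≥ 4 / char. `p`.

A state `s` of a binary-cone tail with polar kernel `⟨e_c + Φ, e_d + Ψ⟩` (`Φ, Ψ` inert,
`…LossyPairTail.exists_tilted_frame`) and boundary on `{c, d}` only: after the LINEAR STRAIGHTENING
`A = shear_c Φ ∘ shear_d Ψ` the polynomial `A s.F` keeps `x^r ∣`, keeps its order `o`, and its degree-`o` monomials are
`x^r` times INERT monomials — the hypothesis `hF` / `hF₂` of `…LossyTiltFreeLegality` / `…LossyTiltFreeSeed`.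
* §1 shears (with the tree's `isHomogeneous_shear`, `pderiv_shear_of_ne`): `polarMap_shear_other`,
  `shear_monomial_of_vanish` (the boundary monomial is fixed), `coeff_shear_shear_eq_initialForm` (degree-`o`
  coefficients only see the initial form);
* §2 **`inert_of_straighten`** — the degree-`o` support of `shear_c Φ (shear_d Ψ s.F)` over `x^r` is free of `c` and
  `d` (`pderiv_shear_self` + `…free_of_pderiv_eq_zero`, degree `o − |r| < p`), with `x^r ∣` and order `≥ o`;
  the one-tilt version `free_of_straighten_one` (only `e_c + Φ` known: the degree-`o` support is free of `c`);
* §3 the QUADRATIC JET `x_i ↦ x_i + Φ′_i x_c²` adds only higher degree: `coeff_jet_monomial`, **`coeff_jet_of_le`**,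
  hence **`inert_of_straighten_jet`**: the same three facts for the fully re-coordinatised parent
  `Θ s.F`, `Θ : x_i ↦ x_i + Φ_i x_c + Ψ_i x_d + Φ′_i x_c²` of `…FrameConjugation`.
[cite: CossartJannsenSaito2020, Def. 2.8, Thm. 3.14] [cite: Humphreys1990, § 3.10 (chain rule)]
bears_on: LADDER-RESOLUTION:D157-DOOR2 (res-dim4-pi · K2(p) = `RidgeBudget.NoAboveFloorTrap p p` · slice C, tilted residual).
Supports stmt-ResolutionOfSingularities-16155 (helper).
-/

set_option linter.dupNamespace false -- mandated namespace of this single-conjunct summit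

noncomputable section

namespace Summit.ResolutionOfSingularities.ResolutionOfSingularities.Theorems.PIDim4

namespace ResCone

open MvPolynomial Finset
open Literature.AlgebraicGeometry.Resolution
open Literature.AlgebraicGeometry.Resolution.CentreBlowup
open Literature.AlgebraicGeometry.Resolution.Hauser2010
open Literature.AlgebraicGeometry.Resolution.HauserPerlega2019
open PointBlowup (polarMap additiveSubspace direction)

variable {K : Type} [Field K]

section Shears

/-- **The polar along `e_c + Φ` commutes with a shear along another letter `d`** (`Φ_d = 0`, `c ≠ d`):
`D_{e_c + Φ} (shear d Ψ g) = shear d Ψ (D_{e_c + Φ} g)`. [folklore] [cite: Humphreys1990, § 3.10 (chain rule)] -/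
theorem polarMap_shear_other {c d : Fin 4} (hcd : c ≠ d) (Ψ : Fin 4 → K) {Φ : Fin 4 → K} (hΦd : Φ d = 0)
    (g : MvPolynomial (Fin 4) K) :
    polarMap (shear d Ψ g) (direction c Φ) = shear d Ψ (polarMap g (direction c Φ)) := by
  classical
  rw [NarrowApolarity.polarMap_apply, NarrowApolarity.polarMap_apply]
  unfold shear
  rw [map_sum]
  refine Finset.sum_congr rfl fun i _ => ?_
  by_cases hid : i = d
  · rw [hid, direction_apply_of_ne (Ne.symm hcd), hΦd, zero_smul, zero_smul, map_zero]
  · rw [map_smul]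
    congr 1
    exact pderiv_shear_of_ne hid Ψ g

/-- A shear fixes a monomial none of whose letters it moves. [folklore] -/
theorem shear_monomial_of_vanish (j : Fin 4) (t : Fin 4 → K) {r : Fin 4 →₀ ℕ} (c₀ : K)
    (hr : ∀ i, i ≠ j → t i ≠ 0 → r i = 0) : shear j t (monomial r c₀) = monomial r c₀ := by
  classical
  unfold shear
  rw [aeval_monomial, algebraMap_eq, monomial_eq]
  congr 1
  rw [Finsupp.prod, Finsupp.prod]
  refine Finset.prod_congr rfl fun i hi => ?_
  by_cases hij : i = j
  · rw [hij, if_pos rfl]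
  · rw [if_neg hij]
    by_cases hti : t i = 0
    · rw [hti, C_0, zero_mul, add_zero]
    · exact absurd (hr i hij hti) (Finsupp.mem_support_iff.mp hi)

/-- **Degree-`o` coefficients of a doubly sheared polynomial only see its initial form** (`o = ord₀ F`). [folklore] -/
theorem coeff_shear_shear_eq_initialForm (c d : Fin 4) (Φ Ψ : Fin 4 → K) {F : MvPolynomial (Fin 4) K} {o : ℕ}
    (ho : ordZero F = o) {m : Fin 4 →₀ ℕ} (hm : m.degree = o) :
    coeff m (shear c Φ (shear d Ψ F)) = coeff m (shear c Φ (shear d Ψ (initialForm F))) := by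
  classical
  have hsum := sum_homogeneousComponent F
  have hin : initialForm F = homogeneousComponent o F := by
    unfold initialForm; rw [ho]; rfl
  conv_lhs => rw [← hsum]
  unfold shear
  rw [map_sum, map_sum, coeff_sum]
  rw [Finset.sum_eq_single o]
  · rw [hin]
  · intro n _ hno
    have hhom : (aeval (fun i => if i = c then (X c : MvPolynomial (Fin 4) K) else X i + C (Φ i) * X c)
        (aeval (fun i => if i = d then (X d : MvPolynomial (Fin 4) K) else X i + C (Ψ i) * X d)
          (homogeneousComponent n F))).IsHomogeneous n :=
      isHomogeneous_shear c Φ (isHomogeneous_shear d Ψ (homogeneousComponent_isHomogeneous n F))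
    exact hhom.coeff_eq_zero (by rw [hm]; exact fun h => hno h.symm)
  · intro hno
    -- `o ≤ totalDegree F` fails: the component is zero
    have hlt : F.totalDegree < o := by rw [Finset.mem_range, not_lt] at hno; omega
    have hz : homogeneousComponent o F = 0 := homogeneousComponent_eq_zero o F hlt
    rw [hz, map_zero, map_zero, coeff_zero]

end Shears

section Straighten

/-- `direction c Φ = e_c + Φ` for `Φ_c = 0`. [folklore] -/
theorem direction_eq_single_add {c : Fin 4} {Φ : Fin 4 → K} (hΦc : Φ c = 0) :
    direction c Φ = (Pi.single c 1 : Fin 4 → K) + Φ := by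
  funext i
  by_cases hic : i = c
  · rw [hic, direction_apply_self, Pi.add_apply, Pi.single_eq_same, hΦc, add_zero]
  · rw [direction_apply_of_ne hic, Pi.add_apply, Pi.single_eq_of_ne hic, zero_add]

/-- **STRAIGHTENING ONE TILT**: if `e_c + Φ ∈ resVertex s` (`Φ_c = 0`, and `Φ` vanishes on the boundary letters),
then `shear_c Φ` keeps `x^r ∣ F`, keeps the order `o`, and its degree-`o` monomials have `x_c`-exponent `r_c`
(shade `o − |r| < p`). [OURS] [cite: CossartJannsenSaito2020, Def. 2.8] -/
theorem free_of_straighten_one (p : ℕ) [Fact p.Prime] [CharP K p] {s : State K} {o : ℕ}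
    (ho : ordZero s.F = o) (hdp : o - s.r.degree < p) (hr : ∀ e ∈ s.F.support, s.r ≤ e)
    {c : Fin 4} {Φ : Fin 4 → K} (hΦc : Φ c = 0) (hΦr : ∀ i, i ≠ c → Φ i ≠ 0 → s.r i = 0)
    (hV : (Pi.single c 1 : Fin 4 → K) + Φ ∈ resVertex s) :
    ∀ m ∈ (shear c Φ s.F).support, s.r ≤ m ∧ o ≤ m.degree ∧ (m.degree = o → m c = s.r c) := by
  classical
  intro m hm
  have hmF := MvPolynomial.mem_support_iff.mp hm
  -- order
  have hsh : ∀ (j : Fin 4) (t : Fin 4 → K) (P : MvPolynomial (Fin 4) K), ordZero P ≤ ordZero (shear j t P) :=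
    fun j t P => le_ordZero_aeval _ (fun i => by by_cases h : i = j <;> simp [h]) _
  have hord : o ≤ m.degree := by
    have h1 := Literature.Barriers.ResolutionOfSingularities.ordZero_le_of_coeff_ne_zero _ _ hmF
    have h2 : (o : ℕ∞) ≤ ordZero (shear c Φ s.F) := by rw [← ho]; exact hsh c Φ s.F
    exact_mod_cast h2.trans h1
  -- `x^r ∣`
  have hfac : shear c Φ s.F = monomial s.r (1 : K) * shear c Φ (s.F.divMonomial s.r) := by
    conv_lhs => rw [eq_monomial_mul_divMonomial hr]
    rw [shear_mul, shear_monomial_of_vanish c Φ 1 hΦr]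
  have hrm : s.r ≤ m := by
    rw [hfac, MvPolynomial.mem_support_iff, coeff_monomial_mul'] at hm
    by_contra h
    exact hm (if_neg h)
  refine ⟨hrm, hord, fun hdeg => ?_⟩
  -- degree `o`: only the initial form `x^r · g` is seen, and `shear g` is `x_c`-free
  have hco := coeff_shear_shear_eq_initialForm c c Φ 0 ho hdeg
  rw [shear_zero, shear_zero, ← monomial_mul_resForm hr, shear_mul, shear_monomial_of_vanish c Φ 1 hΦr,
    coeff_monomial_mul', if_pos hrm, one_mul] at hco
  rw [hco] at hmF
  have hg : (resForm s).IsHomogeneous (o - s.r.degree) := resForm_isHomogeneous ho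
  have hpd : pderiv c (shear c Φ (resForm s)) = 0 := by
    rw [pderiv_shear_self c hΦc, direction_eq_single_add hΦc]
    have h0 : polarMap (resForm s) ((Pi.single c 1 : Fin 4 → K) + Φ) = 0 := LinearMap.mem_ker.mp hV
    rw [h0]; unfold shear; exact map_zero _
  have hfree := free_of_pderiv_eq_zero p (isHomogeneous_shear c Φ hg) hdp hpd
    (m - s.r) (MvPolynomial.mem_support_iff.mpr hmF)
  rw [Finsupp.tsub_apply] at hfree
  have := Finsupp.le_def.mp hrm c
  omega

/-- **STRAIGHTENING BOTH TILTS: THE CONE BECOMES INERT.**  If `e_c + Φ, e_d + Ψ ∈ resVertex s` (tilts vanishing at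
`c, d`; boundary on `{c, d}` only; shade `o − |r| < p`), then every monomial `x^m` of `shear_c Φ (shear_d Ψ s.F)`
satisfies `x^r ∣ x^m`, `|m| ≥ o`, and, in degree `o`, `m_c = r_c` and `m_d = r_d`. [OURS]
[cite: CossartJannsenSaito2020, Def. 2.8, Thm. 3.14] -/
theorem inert_of_straighten (p : ℕ) [Fact p.Prime] [CharP K p] {s : State K} {o : ℕ}
    (ho : ordZero s.F = o) (hdp : o - s.r.degree < p) (hr : ∀ e ∈ s.F.support, s.r ≤ e)
    {c d : Fin 4} (hcd : c ≠ d) (hrs : ∀ i, i ≠ c → i ≠ d → s.r i = 0)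
    {Φ Ψ : Fin 4 → K} (hΦc : Φ c = 0) (hΦd : Φ d = 0) (hΨc : Ψ c = 0) (hΨd : Ψ d = 0)
    (hΦV : (Pi.single c 1 : Fin 4 → K) + Φ ∈ resVertex s) (hΨV : (Pi.single d 1 : Fin 4 → K) + Ψ ∈ resVertex s) :
    ∀ m ∈ (shear c Φ (shear d Ψ s.F)).support,
      s.r ≤ m ∧ o ≤ m.degree ∧ (m.degree = o → m c = s.r c ∧ m d = s.r d) := by
  classical
  intro m hm
  have hmF := MvPolynomial.mem_support_iff.mp hm
  have hΦr : ∀ i, i ≠ c → Φ i ≠ 0 → s.r i = 0 := fun i hic hΦi => hrs i hic (by rintro rfl; exact hΦi hΦd)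
  have hΨr : ∀ i, i ≠ d → Ψ i ≠ 0 → s.r i = 0 := fun i hid hΨi => hrs i (by rintro rfl; exact hΨi hΨc) hid
  -- order
  have hsh : ∀ (j : Fin 4) (t : Fin 4 → K) (P : MvPolynomial (Fin 4) K), ordZero P ≤ ordZero (shear j t P) :=
    fun j t P => le_ordZero_aeval _ (fun i => by by_cases h : i = j <;> simp [h]) _
  have hord : o ≤ m.degree := by
    have h1 := Literature.Barriers.ResolutionOfSingularities.ordZero_le_of_coeff_ne_zero _ _ hmF
    have h2 : (o : ℕ∞) ≤ ordZero (shear c Φ (shear d Ψ s.F)) := by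
      rw [← ho]; exact (hsh d Ψ s.F).trans (hsh c Φ _)
    exact_mod_cast h2.trans h1
  have hfac : shear c Φ (shear d Ψ s.F) = monomial s.r (1 : K) * shear c Φ (shear d Ψ (s.F.divMonomial s.r)) := by
    conv_lhs => rw [eq_monomial_mul_divMonomial hr]
    rw [shear_mul, shear_monomial_of_vanish d Ψ 1 hΨr, shear_mul, shear_monomial_of_vanish c Φ 1 hΦr]
  have hrm : s.r ≤ m := by
    rw [hfac, MvPolynomial.mem_support_iff, coeff_monomial_mul'] at hm
    by_contra h
    exact hm (if_neg h)
  refine ⟨hrm, hord, fun hdeg => ?_⟩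
  have hco := coeff_shear_shear_eq_initialForm c d Φ Ψ ho hdeg
  rw [← monomial_mul_resForm hr, shear_mul, shear_monomial_of_vanish d Ψ 1 hΨr, shear_mul,
    shear_monomial_of_vanish c Φ 1 hΦr, coeff_monomial_mul', if_pos hrm, one_mul] at hco
  rw [hco] at hmF
  have hg : (resForm s).IsHomogeneous (o - s.r.degree) := resForm_isHomogeneous ho
  have hAg : (shear c Φ (shear d Ψ (resForm s))).IsHomogeneous (o - s.r.degree) :=
    isHomogeneous_shear c Φ (isHomogeneous_shear d Ψ hg)
  -- `∂_c` and `∂_d` of the straightened cone vanish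
  have hpc : pderiv c (shear c Φ (shear d Ψ (resForm s))) = 0 := by
    rw [pderiv_shear_self c hΦc, polarMap_shear_other hcd Ψ hΦd, direction_eq_single_add hΦc,
      LinearMap.mem_ker.mp hΦV]
    unfold shear; rw [map_zero, map_zero]
  have hpd : pderiv d (shear c Φ (shear d Ψ (resForm s))) = 0 := by
    rw [pderiv_shear_of_ne (Ne.symm hcd) Φ, pderiv_shear_self d hΨd, direction_eq_single_add hΨd,
      LinearMap.mem_ker.mp hΨV]
    unfold shear; rw [map_zero, map_zero]
  have hmem : m - s.r ∈ (shear c Φ (shear d Ψ (resForm s))).support := MvPolynomial.mem_support_iff.mpr hmF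
  have h1 := free_of_pderiv_eq_zero p hAg hdp hpc (m - s.r) hmem
  have h2 := free_of_pderiv_eq_zero p hAg hdp hpd (m - s.r) hmem
  rw [Finsupp.tsub_apply] at h1 h2
  have := Finsupp.le_def.mp hrm c
  have := Finsupp.le_def.mp hrm d
  constructor <;> omega

end Straighten

section Jet

/-- **The quadratic jet on a monomial**: `coeff_m (J x^e) = [m = e]` for `|m| ≤ |e|`, where
`J : x_i ↦ x_i + Φ′_i x_c²` — the jet only ADDS degree. [folklore] -/
theorem coeff_jet_monomial (c : Fin 4) (Φ' : Fin 4 → K) :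
    ∀ n : ℕ, ∀ e : Fin 4 →₀ ℕ, e.degree = n → ∀ m : Fin 4 →₀ ℕ, m.degree ≤ n →
      coeff m (aeval (fun i => (X i : MvPolynomial (Fin 4) K) + C (Φ' i) * X c ^ 2) (monomial e (1 : K))) =
        if m = e then 1 else 0 := by
  classical
  intro n
  induction n with
  | zero =>
    intro e he m hm
    have he0 : e = 0 := (Finsupp.degree_eq_zero_iff e).mp he
    have hm0 : m = 0 := (Finsupp.degree_eq_zero_iff m).mp (by omega)
    subst he0; subst hm0
    rw [monomial_zero', C_1, map_one, coeff_one, if_pos rfl]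
  | succ n ih =>
    intro e he m hm
    -- split off one letter of `e`
    have hne : e ≠ 0 := fun h => by rw [h, map_zero] at he; exact Nat.succ_ne_zero n he.symm
    obtain ⟨i, hi⟩ := Finsupp.support_nonempty_iff.mpr hne
    have hei : 1 ≤ e i := Nat.one_le_iff_ne_zero.mpr (Finsupp.mem_support_iff.mp hi)
    set e' := e - Finsupp.single i 1 with he'
    have hee' : e = e' + Finsupp.single i 1 := by
      rw [he', tsub_add_cancel_of_le (Finsupp.single_le_iff.mpr hei)]
    have hdeg' : e'.degree = n := by
      have := congrArg Finsupp.degree hee'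
      rw [map_add, Finsupp.degree_single, he] at this
      omega
    have hsplit : monomial e (1 : K) = monomial e' (1 : K) * X i := by
      rw [X, monomial_mul, mul_one, ← hee']
    set Q := aeval (fun i => (X i : MvPolynomial (Fin 4) K) + C (Φ' i) * X c ^ 2) (monomial e' (1 : K)) with hQ
    have hX2 : (X c : MvPolynomial (Fin 4) K) ^ 2 = monomial (Finsupp.single c 2) 1 := X_pow_eq_monomial
    rw [hsplit, map_mul, aeval_X, ← hQ, mul_add, coeff_add, coeff_mul_X', ← mul_assoc, mul_comm Q (C (Φ' i)),
      mul_assoc, coeff_C_mul, hX2, coeff_mul_monomial', mul_one]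
    -- first summand: `x_i`-shift, induction hypothesis
    have h1 : (if i ∈ m.support then coeff (m - Finsupp.single i 1) Q else 0) = if m = e then 1 else 0 := by
      by_cases him : i ∈ m.support
      · have hmi : 1 ≤ m i := Nat.one_le_iff_ne_zero.mpr (Finsupp.mem_support_iff.mp him)
        rw [if_pos him, hQ, ih e' hdeg' (m - Finsupp.single i 1) (by
          have := congrArg Finsupp.degree (tsub_add_cancel_of_le (Finsupp.single_le_iff.mpr hmi))
          rw [map_add, Finsupp.degree_single] at this; omega)]
        by_cases hme : m = e
        · rw [if_pos hme, if_pos]; rw [hme, he']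
        · rw [if_neg hme, if_neg]
          intro h
          apply hme
          rw [hee', ← h, tsub_add_cancel_of_le (Finsupp.single_le_iff.mpr hmi)]
      · rw [if_neg him, if_neg]
        rintro rfl
        exact him (by rw [hee', Finsupp.mem_support_iff, Finsupp.add_apply, Finsupp.single_eq_same]; omega)
    -- second summand: `x_c²`-shift lowers the degree below `|e′|`: zero by the induction hypothesis
    have h2 : (if Finsupp.single c 2 ≤ m then coeff (m - Finsupp.single c 2) Q else 0) = 0 := by
      by_cases hle : Finsupp.single c 2 ≤ m
      · have hmc : 2 ≤ m c := Finsupp.single_le_iff.mp hle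
        have hdegm : (m - Finsupp.single c 2).degree + 2 = m.degree := by
          have := congrArg Finsupp.degree (tsub_add_cancel_of_le hle)
          rw [map_add, Finsupp.degree_single] at this; omega
        rw [if_pos hle, hQ, ih e' hdeg' _ (by omega), if_neg]
        intro h
        have := congrArg Finsupp.degree h
        rw [hdeg'] at this
        omega
      · rw [if_neg hle]
    rw [h1, h2, mul_zero, add_zero]

/-- **THE QUADRATIC JET DOES NOT TOUCH LOW DEGREES**: if every monomial of `P` has degree `≥ |m|` then
`coeff_m (J P) = coeff_m P`. [folklore] -/
theorem coeff_jet_of_le (c : Fin 4) (Φ' : Fin 4 → K) {P : MvPolynomial (Fin 4) K} {m : Fin 4 →₀ ℕ}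
    (hP : ∀ e ∈ P.support, m.degree ≤ e.degree) :
    coeff m (aeval (fun i => (X i : MvPolynomial (Fin 4) K) + C (Φ' i) * X c ^ 2) P) = coeff m P := by
  classical
  conv_lhs => rw [P.as_sum]
  rw [map_sum, coeff_sum]
  conv_rhs => rw [P.as_sum, coeff_sum]
  refine Finset.sum_congr rfl fun e he => ?_
  rw [← mul_one (coeff e P), ← smul_eq_mul, ← smul_monomial, map_smul, coeff_smul, coeff_smul,
    coeff_jet_monomial c Φ' e.degree e rfl m (hP e he), coeff_monomial]
  by_cases h : e = m
  · rw [if_pos h, if_pos h.symm]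
  · rw [if_neg h, if_neg (Ne.symm h)]

/-- Every monomial of `J P` has degree at least the order of `P` (the jet has no constant terms). [folklore] -/
theorem le_degree_of_mem_support_jet (c : Fin 4) (Φ' : Fin 4 → K) {P : MvPolynomial (Fin 4) K} {o : ℕ}
    (hP : ∀ e ∈ P.support, o ≤ e.degree) {m : Fin 4 →₀ ℕ}
    (hm : m ∈ (aeval (fun i => (X i : MvPolynomial (Fin 4) K) + C (Φ' i) * X c ^ 2) P).support) :
    o ≤ m.degree := by
  by_cases hP0 : P = 0
  · rw [hP0, map_zero] at hm; simp at hm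
  obtain ⟨n, hn⟩ := exists_ordZero_eq_natCast hP0
  have hon : o ≤ n := by
    obtain ⟨⟨d₀, hd₀, hd₀deg⟩, -⟩ := (ordZero_eq_nat_iff _ _).mp hn
    have := hP d₀ (MvPolynomial.mem_support_iff.mpr hd₀)
    omega
  have h1 := Literature.Barriers.ResolutionOfSingularities.ordZero_le_of_coeff_ne_zero _ _
    (MvPolynomial.mem_support_iff.mp hm)
  have h2 : (n : ℕ∞) ≤ ordZero (aeval (fun i => (X i : MvPolynomial (Fin 4) K) + C (Φ' i) * X c ^ 2) P) := by
    rw [← hn]; exact le_ordZero_aeval _ (fun i => by simp) _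
  have := h2.trans h1
  exact le_trans hon (by exact_mod_cast this)

/-- **THE FULLY RE-COORDINATISED PARENT** `Θ s.F`, `Θ : x_i ↦ x_i + Φ_i x_c + Ψ_i x_d + Φ′_i x_c²`, has `x^r ∣`, order
`≥ o`, and degree-`o` monomials `x^r` times inert — the hypothesis `hF` of `…LossyTiltFreeSeed`. [OURS]
[cite: CossartJannsenSaito2020, Def. 2.8, Thm. 3.14] -/
theorem inert_of_straighten_jet (p : ℕ) [Fact p.Prime] [CharP K p] {s : State K} {o : ℕ}
    (ho : ordZero s.F = o) (hdp : o - s.r.degree < p) (hr : ∀ e ∈ s.F.support, s.r ≤ e)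
    {c d : Fin 4} (hcd : c ≠ d) (hrs : ∀ i, i ≠ c → i ≠ d → s.r i = 0)
    {Φ Ψ Φ' : Fin 4 → K} (hΦc : Φ c = 0) (hΦd : Φ d = 0) (hΨc : Ψ c = 0) (hΨd : Ψ d = 0)
    (hΦ'c : Φ' c = 0) (hΦ'd : Φ' d = 0)
    (hΦV : (Pi.single c 1 : Fin 4 → K) + Φ ∈ resVertex s) (hΨV : (Pi.single d 1 : Fin 4 → K) + Ψ ∈ resVertex s) :
    ∀ m ∈ (aeval (fun i => (X i : MvPolynomial (Fin 4) K) + C (Φ i) * X c + C (Ψ i) * X d + C (Φ' i) * X c ^ 2)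
      s.F).support,
      s.r ≤ m ∧ o ≤ m.degree ∧ (m.degree = o → degIn ((Finset.univ.erase c).erase d) m = o - s.r.degree) := by
  classical
  -- `Θ = J ∘ A`: the jet after the linear straightening
  have hΘ : aeval (fun i => (X i : MvPolynomial (Fin 4) K) + C (Φ i) * X c + C (Ψ i) * X d + C (Φ' i) * X c ^ 2) s.F
      = aeval (fun i => (X i : MvPolynomial (Fin 4) K) + C (Φ' i) * X c ^ 2) (shear c Φ (shear d Ψ s.F)) := by
    rw [shear_eq_aeval, shear_eq_aeval, ← AlgHom.comp_apply, ← AlgHom.comp_apply]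
    congr 1
    have hdc : d ≠ c := fun h => hcd h.symm
    refine MvPolynomial.algHom_ext fun i => ?_
    simp only [AlgHom.comp_apply, aeval_X]
    by_cases hic : i = c
    · subst hic; simp [hcd, hΦc, hΨc, hΦ'c]
    · by_cases hid : i = d
      · subst hid; simp [hic, hΦd, hΨd, hΦ'd]
      · simp [hic, hid, hdc, hΦ'c, hΦd, hΦ'd]
        ring
  have hA := inert_of_straighten p ho hdp hr hcd hrs hΦc hΦd hΨc hΨd hΦV hΨV
  intro m hm
  rw [hΘ] at hm
  have hord : o ≤ m.degree := le_degree_of_mem_support_jet c Φ' (fun e he => (hA e he).2.1) hm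
  -- `x^r ∣`: the jet fixes `x_c`, `x_d`, hence `x^r`
  have hrm : s.r ≤ m := by
    have hΦr : ∀ i, i ≠ c → Φ i ≠ 0 → s.r i = 0 := fun i hic hΦi => hrs i hic (by rintro rfl; exact hΦi hΦd)
    have hΨr : ∀ i, i ≠ d → Ψ i ≠ 0 → s.r i = 0 := fun i hid hΨi => hrs i (by rintro rfl; exact hΨi hΨc) hid
    have hfac : shear c Φ (shear d Ψ s.F) = monomial s.r (1 : K) * shear c Φ (shear d Ψ (s.F.divMonomial s.r)) := by
      conv_lhs => rw [eq_monomial_mul_divMonomial hr]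
      rw [shear_mul, shear_monomial_of_vanish d Ψ 1 hΨr, shear_mul, shear_monomial_of_vanish c Φ 1 hΦr]
    have hJr : aeval (fun i => (X i : MvPolynomial (Fin 4) K) + C (Φ' i) * X c ^ 2) (monomial s.r (1 : K)) =
        monomial s.r 1 := by
      rw [aeval_monomial, algebraMap_eq, monomial_eq]
      simp only [C_1, one_mul]
      rw [Finsupp.prod, Finsupp.prod]
      refine Finset.prod_congr rfl fun i hi => ?_
      have hri : s.r i ≠ 0 := Finsupp.mem_support_iff.mp hi
      have hicd : i = c ∨ i = d := by
        by_contra h; push Not at h; exact hri (hrs i h.1 h.2)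
      rcases hicd with rfl | rfl
      · rw [hΦ'c, C_0, zero_mul, add_zero]
      · rw [hΦ'd, C_0, zero_mul, add_zero]
    rw [hfac, map_mul, hJr, MvPolynomial.mem_support_iff, coeff_monomial_mul'] at hm
    by_contra h
    exact hm (if_neg h)
  refine ⟨hrm, hord, fun hdeg => ?_⟩
  have hco := coeff_jet_of_le c Φ' (P := shear c Φ (shear d Ψ s.F)) (m := m)
    (fun e he => by rw [hdeg]; exact (hA e he).2.1)
  have hm' : m ∈ (shear c Φ (shear d Ψ s.F)).support := by
    rw [MvPolynomial.mem_support_iff, ← hco]; exact MvPolynomial.mem_support_iff.mp hm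
  obtain ⟨hmc, hmd⟩ := (hA m hm').2.2 hdeg
  have hsplit := degree_eq_apply_add_apply_add_degIn hcd m
  have hrsplit := degree_eq_apply_add_apply_add_degIn hcd s.r
  have hrP : degIn ((Finset.univ.erase c).erase d) s.r = 0 := degIn_eq_zero_iff.mpr fun i hi =>
    hrs i (Finset.ne_of_mem_erase (Finset.mem_of_mem_erase hi)) (Finset.ne_of_mem_erase hi)
  omega

end Jet

end ResCone

end Summit.ResolutionOfSingularities.ResolutionOfSingularities.Theorems.PIDim4

end
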